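import Literature.Analysis.FluidPDE.CheskidovDaiOccupationCriterion
import Literature.Analysis.FluidPDE.DissipationWavenumberMeasurable
import Literature.Analysis.FluidPDE.MollifiedSliceTools
import Mathlib.Topology.Algebra.Order.LiminfLimsup

/-!
# Fluid computer — the LEVEL-OCCUPATION (clock) FLOOR of a blow-up, conditional on Cheskidov–Dai's
# criterion (rung R2/R3; pub-fluidc-lit gen 37)

HONEST FRAMING (cell `pub-fluidc`, verbatim): *low prior, high value-of-information experiment on Tao's
machine paradigm; NOT a claim that NS blows up.* Theorem side of the cell; nothing here is evidence of
blow-up.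

HOME/PLAN.md §0 backs the amplitude rung's floor `r ≥ 1` by Cheskidov–Shvydkoy 2010 (tree:
`LevelReynoldsFloor.dyadic_floor`) and quotes, as a heuristic, the "spec clock" `T_n ≲ c_T/(k_n U_n)` of a
cascade step. The printed theorem that turns the clock into a NECESSITY is Cheskidov–Dai's low-mode
criterion (arXiv:1507.06611 = Proc. Edinburgh Math. Soc. 2025, Thm. 1.1; tree, as a named fact:
`Literature.Analysis.FluidPDE.cheskidov_dai_occupation`): with `Λ = Λ_{c,ν}` the dissipation wavenumber
(`Literature.Analysis.FluidPDE.dissipationWavenumber`), a classical Leray–Hopf solution on `[0,T)` whose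
LEVEL OCCUPATIONS `O_q := ∫_{(T/2,T) ∩ {Λ(u(t)) ≥ 2^q}} 2^q ‖Δ̇_q u(t)‖_∞ dt` satisfy `limsup_q O_q ≤ c`
continues past `T`. This file states the contrapositive in the cell's vocabulary of maximal smooth
solutions and reads it as a clock, CONDITIONALLY on the named fact (hypothesis `h : cheskidov_dai_occupation`
of every theorem; nothing is smuggled: the fact is a published theorem with a different statement):

* `occupation_floor` — for a maximal smooth solution with finite lifespan `T`, Leray–Hopf from its rapidly
  decaying datum: `c < limsup_q O_q`; `frequently_occupation_gt` — `O_q > c` at infinitely many levels;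
* `occupation_le_residence` (unconditional bookkeeping) — `O_q ≤ 2^q · U_q · R_q` with the level
  sup-amplitude `U_q = sup_{t ∈ (T/2,T)} ‖Δ̇_q u(t)‖_∞` and the RESIDENCE TIME
  `R_q = |{t ∈ (T/2,T) : Λ(u(t)) ≥ 2^q}|` of the front at or above level `q`;
* `residence_floor` — hence `2^q · U_q · R_q > c` at infinitely many levels: in cascade words
  `k_q U_q T_q > c`, the front must dwell at or above level `q` for at least `c` eddy turn-over times
  `(k_q U_q)⁻¹`, infinitely often — the clock necessity; `residence_pos` — in particular the front is at or
  above infinitely many levels for a positive-measure set of times in the last half of the lifespan;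
* the BUDGET rail (unconditional; Cheskidov–Shvydkoy 2014 Lemma 4.1 in residence currency):
  `sum_two_pow_ite_le` (`∑_{q ≤ N} 2^q 1_{2^q ≤ L} ≤ 2L`), `sum_innerResidence_le`
  (`∑_{q ≤ N} 2^q ∫_{(T/2,T)} 1_{Λ ≥ 2^q} ≤ 2 ∫_{(T/2,T)} Λ`, inner residences = lower integrals of the
  indicators) and `sum_innerResidence_lt_top` (finite for every Leray–Hopf solution, tree
  `exists_lintegral_dissipationWavenumber_le`): the weighted residences are summable, so along the occupied
  levels `2^q R_q → 0` while `2^q U_q R_q > c` — the level amplitudes must diverge there, consistently with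
  the floor `U_q ≥ c ν 2^q` of `LevelReynoldsFloor`;
* ONE CLOCK (appended; tree `Literature.Analysis.FluidPDE.DissipationWavenumberMeasurable`): for
  Leray–Hopf solutions `t ↦ Λ_{c,ν}(u(t))` is a.e.-measurable, so the inner residence of the budget IS the
  outer residence `R_q` of the floor (`innerResidence_eq_residence`), and the budget holds in the floor's
  currency: `sum_residence_le`, `tsum_residence_lt_top` (`∑_q 2^q R_q ≤ 2∫_{(T/2,T)}Λ < ∞`);
* ENERGY FLOOR (appended): `exists_blockSup_le_energy` (`U_q ≤ C 2^{3q/2} ‖u(0)‖₂`, Bernstein + Leray's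
  energy inequality) and `residence_floor_energy` (`c < C · 2^{5q/2} · ‖u(0)‖₂ · R_q` at infinitely many
  `q`: `τ_res(q) ≳ E₀^{-1/2} k_q^{-5/2}` infinitely often — the weak-`L^{5/2}` tail of the front).

With `LevelReynoldsFloor` (amplitude floor), `LambdaFrontier` (frontier unbounded, `∫Λ < ∞`),
`LambdaCeiling` and `InviscidLevelTransfer` this is the fifth typed face of the rung's Λ-dictionary:
FLOOR / CLOCK-budget (`L¹`) / CEILING / TWIN / OCCUPATION.

## References

* A. Cheskidov, M. Dai, *Regularity criteria for the 3D Navier–Stokes and MHD equations*,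
  arXiv:1507.06611 = Proc. Edinburgh Math. Soc. (2025), doi:10.1017/s0013091525100813, Thm. 1.1.
  [CheskidovDai2015]
* A. Cheskidov, R. Shvydkoy, J. Math. Fluid Mech. 16 (2014) 263–273 = arXiv:1102.1944, §3.
  [CheskidovShvydkoy2011]
-/

noncomputable section

open MeasureTheory Set Function Filter Topology
open scoped ENNReal NNReal
open Literature.Analysis.FluidPDE Literature.Analysis.FunctionSpaces

namespace Summit.NavierStokesRegularity.FluidComputer.LevelOccupationFloor

/-- The level-`q` OCCUPATION of a trajectory on `(T/2, T)` at threshold `c`, viscosity `ν`: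
`O_q = ∫_{(T/2,T)} 1_{2^q ≤ Λ_{c,ν}(u(t))} 2^q ‖Δ̇_q u(t)‖_∞ dt` (lower Lebesgue integral), the quantity of
Cheskidov–Dai's criterion — written out, not a new definition. [cite: CheskidovDai2015, §1 Thm. 1.1] -/
theorem occupation_eq (c ν T : ℝ) (u : ℝ → EuclideanSpace ℝ (Fin 3) → EuclideanSpace ℝ (Fin 3)) (q : ℕ) :
    (∫⁻ τ in Ioo (T / 2) T, {τ | (2 : ℝ≥0∞) ^ q ≤ dissipationWavenumber c ν (u τ)}.indicator
        (fun τ => (2 : ℝ≥0∞) ^ q * eLpNorm (blockFn (q : ℤ) (u τ)) ∞ volume) τ) =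
      ∫⁻ τ, (Ioo (T / 2) T ∩ {τ | (2 : ℝ≥0∞) ^ q ≤ dissipationWavenumber c ν (u τ)}).indicator
        (fun τ => (2 : ℝ≥0∞) ^ q * eLpNorm (blockFn (q : ℤ) (u τ)) ∞ volume) τ := by
  rw [← lintegral_indicator measurableSet_Ioo, Set.indicator_indicator]

/-- **The occupation floor** (contrapositive of Cheskidov–Dai's criterion for maximal smooth solutions):
conditionally on `cheskidov_dai_occupation`, there is an absolute `c > 0` such that every maximal smooth
solution `(u, p)` of the unforced Navier–Stokes system on `ℝ³ × [0,T)` with finite lifespan `T > 0`, `ν > 0`,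
which is Leray–Hopf from its rapidly decaying datum `u 0`, has
`c < limsup_{q → ∞} ∫_{(T/2,T)} 1_{2^q ≤ Λ_{c,ν}(u(t))} 2^q ‖Δ̇_q u(t)‖_∞ dt`. [cite: CheskidovDai2015, §1 Thm. 1.1] -/
theorem occupation_floor (h : cheskidov_dai_occupation) :
    ∃ c : ℝ, 0 < c ∧ ∀ (ν T : ℝ), 0 < ν → 0 < T →
      ∀ (u : ℝ → EuclideanSpace ℝ (Fin 3) → EuclideanSpace ℝ (Fin 3))
        (p : ℝ → EuclideanSpace ℝ (Fin 3) → ℝ),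
      IsMaximalSmoothSolution ν 0 u p T → IsLerayHopfOn T ν 0 (u 0) u → HasRapidSpatialDecay (u 0) →
      ENNReal.ofReal c < limsup (fun q : ℕ => ∫⁻ τ in Ioo (T / 2) T,
          {τ | (2 : ℝ≥0∞) ^ q ≤ dissipationWavenumber c ν (u τ)}.indicator
            (fun τ => (2 : ℝ≥0∞) ^ q * eLpNorm (blockFn (q : ℤ) (u τ)) ∞ volume) τ) atTop := by
  obtain ⟨c, hc, H⟩ := h
  refine ⟨c, hc, fun ν T hν hT u p hmax hLH hdec => ?_⟩
  by_contra hle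
  exact hmax.2 (H ν T hν hT u p hmax.1 hLH hdec (not_lt.1 hle))

/-- **Infinitely many occupied levels**: with the constant of `occupation_floor`, the level occupation
exceeds `c` at infinitely many levels `q`. [cite: CheskidovDai2015, §1 Thm. 1.1] -/
theorem frequently_occupation_gt (h : cheskidov_dai_occupation) :
    ∃ c : ℝ, 0 < c ∧ ∀ (ν T : ℝ), 0 < ν → 0 < T →
      ∀ (u : ℝ → EuclideanSpace ℝ (Fin 3) → EuclideanSpace ℝ (Fin 3))
        (p : ℝ → EuclideanSpace ℝ (Fin 3) → ℝ),
      IsMaximalSmoothSolution ν 0 u p T → IsLerayHopfOn T ν 0 (u 0) u → HasRapidSpatialDecay (u 0) →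
      ∃ᶠ q : ℕ in atTop, ENNReal.ofReal c < ∫⁻ τ in Ioo (T / 2) T,
          {τ | (2 : ℝ≥0∞) ^ q ≤ dissipationWavenumber c ν (u τ)}.indicator
            (fun τ => (2 : ℝ≥0∞) ^ q * eLpNorm (blockFn (q : ℤ) (u τ)) ∞ volume) τ := by
  obtain ⟨c, hc, H⟩ := occupation_floor h
  exact ⟨c, hc, fun ν T hν hT u p hmax hLH hdec =>
    frequently_lt_of_lt_limsup (by isBoundedDefault) (H ν T hν hT u p hmax hLH hdec)⟩

/-- **Occupation ≤ wavenumber × level sup-amplitude × residence time** (bookkeeping, unconditional): for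
every trajectory, level `q`, threshold and viscosity,
`O_q ≤ 2^q · (sup_{t ∈ (T/2,T)} ‖Δ̇_q u(t)‖_∞) · |(T/2,T) ∩ {Λ_{c,ν}(u(t)) ≥ 2^q}|` (outer measure of the
residence set; no measurability needed). [folklore] -/
theorem occupation_le_residence (c ν T : ℝ)
    (u : ℝ → EuclideanSpace ℝ (Fin 3) → EuclideanSpace ℝ (Fin 3)) (q : ℕ) :
    (∫⁻ τ in Ioo (T / 2) T, {τ | (2 : ℝ≥0∞) ^ q ≤ dissipationWavenumber c ν (u τ)}.indicator
        (fun τ => (2 : ℝ≥0∞) ^ q * eLpNorm (blockFn (q : ℤ) (u τ)) ∞ volume) τ) ≤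
      (2 : ℝ≥0∞) ^ q * (⨆ τ ∈ Ioo (T / 2) T, eLpNorm (blockFn (q : ℤ) (u τ)) ∞ volume) *
        volume (Ioo (T / 2) T ∩ {τ | (2 : ℝ≥0∞) ^ q ≤ dissipationWavenumber c ν (u τ)}) := by
  set S := Ioo (T / 2) T with hS
  set A := {τ | (2 : ℝ≥0∞) ^ q ≤ dissipationWavenumber c ν (u τ)} with hA
  set M := (2 : ℝ≥0∞) ^ q * ⨆ τ ∈ S, eLpNorm (blockFn (q : ℤ) (u τ)) ∞ volume with hM
  -- pointwise bound on `S`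
  have hpt : ∀ τ ∈ S, A.indicator (fun τ => (2 : ℝ≥0∞) ^ q * eLpNorm (blockFn (q : ℤ) (u τ)) ∞ volume) τ ≤
      A.indicator (fun _ => M) τ := fun τ hτ =>
    Set.indicator_le_indicator (mul_le_mul' le_rfl
      (le_iSup₂_of_le (f := fun τ (_ : τ ∈ S) => eLpNorm (blockFn (q : ℤ) (u τ)) ∞ volume) τ hτ le_rfl))
  calc (∫⁻ τ in S, A.indicator (fun τ => (2 : ℝ≥0∞) ^ q * eLpNorm (blockFn (q : ℤ) (u τ)) ∞ volume) τ)
      ≤ ∫⁻ τ in S, A.indicator (fun _ => M) τ := setLIntegral_mono' measurableSet_Ioo hpt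
    _ = ∫⁻ τ, (S ∩ A).indicator (fun _ => M) τ := by
        rw [← lintegral_indicator measurableSet_Ioo, Set.indicator_indicator]
    _ ≤ ∫⁻ τ in S ∩ A, M := lintegral_indicator_le _ _
    _ = M * volume (S ∩ A) := setLIntegral_const _ _
    _ = _ := by rw [hM]

/-- **The residence (clock) floor.** Conditionally on `cheskidov_dai_occupation`: with an absolute `c > 0`,
every maximal smooth solution with finite lifespan `T`, Leray–Hopf from its rapidly decaying datum, has at
INFINITELY MANY levels `q`
`c < 2^q · (sup_{t ∈ (T/2,T)} ‖Δ̇_q u(t)‖_∞) · |{t ∈ (T/2,T) : Λ_{c,ν}(u(t)) ≥ 2^q}|` — wavenumber × level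
velocity × residence time of the front at or above the level: the front dwells at level `q` or higher for at
least `c` eddy turn-over times `(k_q U_q)⁻¹`, infinitely often (the cell's spec clock as a necessity).
[cite: CheskidovDai2015, §1 Thm. 1.1] -/
theorem residence_floor (h : cheskidov_dai_occupation) :
    ∃ c : ℝ, 0 < c ∧ ∀ (ν T : ℝ), 0 < ν → 0 < T →
      ∀ (u : ℝ → EuclideanSpace ℝ (Fin 3) → EuclideanSpace ℝ (Fin 3))
        (p : ℝ → EuclideanSpace ℝ (Fin 3) → ℝ),
      IsMaximalSmoothSolution ν 0 u p T → IsLerayHopfOn T ν 0 (u 0) u → HasRapidSpatialDecay (u 0) →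
      ∃ᶠ q : ℕ in atTop, ENNReal.ofReal c <
        (2 : ℝ≥0∞) ^ q * (⨆ τ ∈ Ioo (T / 2) T, eLpNorm (blockFn (q : ℤ) (u τ)) ∞ volume) *
          volume (Ioo (T / 2) T ∩ {τ | (2 : ℝ≥0∞) ^ q ≤ dissipationWavenumber c ν (u τ)}) := by
  obtain ⟨c, hc, H⟩ := frequently_occupation_gt h
  exact ⟨c, hc, fun ν T hν hT u p hmax hLH hdec =>
    (H ν T hν hT u p hmax hLH hdec).mono fun q hq =>
      hq.trans_le (occupation_le_residence c ν T u q)⟩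

/-- **Positive residence at infinitely many levels**: in the same setting the front `Λ_{c,ν}(u(t))` is at or
above level `q` for a set of times of POSITIVE (outer) measure in the last half of the lifespan, for
infinitely many `q` (and the level sup-amplitude there is nonzero). [cite: CheskidovDai2015, §1 Thm. 1.1] -/
theorem residence_pos (h : cheskidov_dai_occupation) :
    ∃ c : ℝ, 0 < c ∧ ∀ (ν T : ℝ), 0 < ν → 0 < T →
      ∀ (u : ℝ → EuclideanSpace ℝ (Fin 3) → EuclideanSpace ℝ (Fin 3))
        (p : ℝ → EuclideanSpace ℝ (Fin 3) → ℝ),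
      IsMaximalSmoothSolution ν 0 u p T → IsLerayHopfOn T ν 0 (u 0) u → HasRapidSpatialDecay (u 0) →
      ∃ᶠ q : ℕ in atTop,
        0 < volume (Ioo (T / 2) T ∩ {τ | (2 : ℝ≥0∞) ^ q ≤ dissipationWavenumber c ν (u τ)}) := by
  obtain ⟨c, hc, H⟩ := residence_floor h
  refine ⟨c, hc, fun ν T hν hT u p hmax hLH hdec =>
    (H ν T hν hT u p hmax hLH hdec).mono fun q hq => pos_iff_ne_zero.2 fun h0 => ?_⟩
  rw [h0, mul_zero] at hq
  exact ENNReal.not_lt_zero hq  -- `ofReal c < 0` is absurd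

/-! ## The budget rail (unconditional): inner residence times are summable against `2^q` -/

section Budget

/-- Dyadic counting under a ceiling: `∑_{q ≤ N} 2^q · 1_{2^q ≤ L} ≤ 2L` in `[0,∞]`. [folklore] -/
theorem sum_two_pow_ite_le (L : ℝ≥0∞) (N : ℕ) :
    ∑ q ∈ Finset.range (N + 1), (if (2 : ℝ≥0∞) ^ q ≤ L then (2 : ℝ≥0∞) ^ q else 0) ≤ 2 * L := by
  induction N with
  | zero =>
      simp only [zero_add, Finset.range_one, Finset.sum_singleton, pow_zero]
      split_ifs with h
      · calc (1 : ℝ≥0∞) ≤ L := h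
          _ ≤ 2 * L := le_mul_of_one_le_left bot_le one_le_two
      · exact bot_le
  | succ N ih =>
      rw [Finset.sum_range_succ]
      by_cases hN : (2 : ℝ≥0∞) ^ (N + 1) ≤ L
      · -- every term is switched on: the geometric sum `≤ 2^{N+1} + 2^{N+1} ≤ 2L`
        have hgeom : ∀ M : ℕ, ∑ q ∈ Finset.range M, (2 : ℝ≥0∞) ^ q ≤ (2 : ℝ≥0∞) ^ M := by
          intro M
          induction M with
          | zero => simp
          | succ M ihM =>
              rw [Finset.sum_range_succ, pow_succ, mul_two]
              exact add_le_add ihM le_rfl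
        have hall : ∑ q ∈ Finset.range (N + 1), (if (2 : ℝ≥0∞) ^ q ≤ L then (2 : ℝ≥0∞) ^ q else 0) ≤
            (2 : ℝ≥0∞) ^ (N + 1) := by
          refine (Finset.sum_le_sum fun q _ => ?_).trans (hgeom (N + 1))
          split_ifs
          · exact le_rfl
          · exact bot_le
        rw [if_pos hN]
        calc _ ≤ (2 : ℝ≥0∞) ^ (N + 1) + 2 ^ (N + 1) := add_le_add hall le_rfl
          _ = 2 * 2 ^ (N + 1) := (two_mul _).symm
          _ ≤ 2 * L := mul_le_mul' le_rfl hN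
      · rw [if_neg hN, add_zero]
        exact ih

/-- Superadditivity of the lower time integral over finitely many levels (no measurability):
`∑_{q < M} ∫_S f_q ≤ ∫_S ∑_{q < M} f_q`. [folklore] -/
private theorem sum_range_setLIntegral_le (S : Set ℝ) (M : ℕ) (f : ℕ → ℝ → ℝ≥0∞) :
    ∑ q ∈ Finset.range M, ∫⁻ τ in S, f q τ ≤ ∫⁻ τ in S, ∑ q ∈ Finset.range M, f q τ := by
  induction M with
  | zero => simp
  | succ M ih =>
      rw [Finset.sum_range_succ]
      calc (∑ q ∈ Finset.range M, ∫⁻ τ in S, f q τ) + ∫⁻ τ in S, f M τ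
          ≤ (∫⁻ τ in S, ∑ q ∈ Finset.range M, f q τ) + ∫⁻ τ in S, f M τ := add_le_add ih le_rfl
        _ ≤ ∫⁻ τ in S, (∑ q ∈ Finset.range M, f q τ) + f M τ := le_lintegral_add _ _
        _ = ∫⁻ τ in S, ∑ q ∈ Finset.range (M + 1), f q τ := by simp_rw [Finset.sum_range_succ]

/-- **Residence budget along a trajectory** (the `L¹` rail in residence currency; unconditional): with the
INNER residence `∫_{(T/2,T)} 1_{Λ_{c,ν}(u(t)) ≥ 2^q} dt` (lower integral of the indicator; it equals the
measure of the residence set whenever that set is measurable), for every `N`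
`∑_{q ≤ N} 2^q ∫_{(T/2,T)} 1_{Λ(u(t)) ≥ 2^q} dt ≤ 2 ∫_{(T/2,T)} Λ(u(t)) dt` — so by Cheskidov–Shvydkoy 2014
Lemma 4.1 (tree: `exists_lintegral_dissipationWavenumber_le`) the weighted residences of a Leray–Hopf
solution are summable: the front cannot dwell long at high levels. [cite: CheskidovShvydkoy2011, Lemma 4.1] -/
theorem sum_innerResidence_le (c ν T : ℝ)
    (u : ℝ → EuclideanSpace ℝ (Fin 3) → EuclideanSpace ℝ (Fin 3)) (N : ℕ) :
    ∑ q ∈ Finset.range (N + 1), (2 : ℝ≥0∞) ^ q *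
        ∫⁻ τ in Ioo (T / 2) T, {τ | (2 : ℝ≥0∞) ^ q ≤ dissipationWavenumber c ν (u τ)}.indicator
          (fun _ => (1 : ℝ≥0∞)) τ ≤
      2 * ∫⁻ τ in Ioo (T / 2) T, dissipationWavenumber c ν (u τ) := by
  have hpt : ∀ τ : ℝ, ∑ q ∈ Finset.range (N + 1), (2 : ℝ≥0∞) ^ q *
      {τ | (2 : ℝ≥0∞) ^ q ≤ dissipationWavenumber c ν (u τ)}.indicator (fun _ => (1 : ℝ≥0∞)) τ ≤
      2 * dissipationWavenumber c ν (u τ) := by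
    intro τ
    refine le_trans (le_of_eq (Finset.sum_congr rfl fun q _ => ?_))
      (sum_two_pow_ite_le (dissipationWavenumber c ν (u τ)) N)
    simp only [Set.indicator_apply, Set.mem_setOf_eq, mul_ite, mul_one, mul_zero]
  calc ∑ q ∈ Finset.range (N + 1), (2 : ℝ≥0∞) ^ q *
        ∫⁻ τ in Ioo (T / 2) T, {τ | (2 : ℝ≥0∞) ^ q ≤ dissipationWavenumber c ν (u τ)}.indicator
          (fun _ => (1 : ℝ≥0∞)) τ
      = ∑ q ∈ Finset.range (N + 1), ∫⁻ τ in Ioo (T / 2) T, (2 : ℝ≥0∞) ^ q *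
          {τ | (2 : ℝ≥0∞) ^ q ≤ dissipationWavenumber c ν (u τ)}.indicator (fun _ => (1 : ℝ≥0∞)) τ :=
        Finset.sum_congr rfl fun q _ =>
          (lintegral_const_mul' _ _ (ENNReal.pow_ne_top (by norm_num))).symm
    _ ≤ ∫⁻ τ in Ioo (T / 2) T, ∑ q ∈ Finset.range (N + 1), (2 : ℝ≥0∞) ^ q *
          {τ | (2 : ℝ≥0∞) ^ q ≤ dissipationWavenumber c ν (u τ)}.indicator (fun _ => (1 : ℝ≥0∞)) τ :=
        sum_range_setLIntegral_le _ _ _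
    _ ≤ ∫⁻ τ in Ioo (T / 2) T, 2 * dissipationWavenumber c ν (u τ) := lintegral_mono fun τ => hpt τ
    _ = 2 * ∫⁻ τ in Ioo (T / 2) T, dissipationWavenumber c ν (u τ) :=
        lintegral_const_mul' _ _ (by norm_num)

/-- **The budget is finite for Leray–Hopf solutions** (Cheskidov–Shvydkoy 2014 Lemma 4.1, tree): for
`c > 0`, `ν > 0`, `T > 0` and `u` Leray–Hopf on `[0,T]` from `u 0`,
`∑_{q ≤ N} 2^q ∫_{(T/2,T)} 1_{Λ_{c,ν}(u(t)) ≥ 2^q} dt ≤ 2 ∫_{(0,T)} Λ < ∞`, uniformly in `N`. [cite: CheskidovShvydkoy2011, Lemma 4.1] -/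
theorem sum_innerResidence_lt_top {c ν T : ℝ}
    {u : ℝ → EuclideanSpace ℝ (Fin 3) → EuclideanSpace ℝ (Fin 3)} (hLH : IsLerayHopfOn T ν 0 (u 0) u)
    (hc : 0 < c) (hν : 0 < ν) (hT : 0 < T) (N : ℕ) :
    ∑ q ∈ Finset.range (N + 1), (2 : ℝ≥0∞) ^ q *
        ∫⁻ τ in Ioo (T / 2) T, {τ | (2 : ℝ≥0∞) ^ q ≤ dissipationWavenumber c ν (u τ)}.indicator
          (fun _ => (1 : ℝ≥0∞)) τ < ∞ := by
  obtain ⟨C, hC⟩ := exists_lintegral_dissipationWavenumber_le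
  have hfin : ∫⁻ τ in Ioo 0 T, dissipationWavenumber c ν (u τ) < ∞ :=
    (hC c ν T (u 0) u hc hν hT hLH).trans_lt
      (ENNReal.add_lt_top.2 ⟨ENNReal.ofReal_lt_top, ENNReal.ofReal_lt_top⟩)
  have hsub : Ioo (T / 2) T ⊆ Ioo 0 T := Ioo_subset_Ioo (by linarith) le_rfl
  refine (sum_innerResidence_le c ν T u N).trans_lt (ENNReal.mul_lt_top (by simp) ?_)
  exact (lintegral_mono_set hsub).trans_lt hfin

end Budget

/-! ## One residence time (Leray–Hopf solutions): the floor's OUTER residence equals the budget's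
INNER residence, so the budget holds in the floor's currency -/

section OneClock

/-- **Inner residence = outer residence** for Leray–Hopf solutions: the dissipation wavenumber of a
Leray–Hopf solution is an a.e.-measurable function of time (tree:
`IsLerayHopfOn.aemeasurable_dissipationWavenumber`, from the weak `L²` continuity of the solution), so
for `T > 0` the lower integral over `(T/2, T)` of the indicator of `{Λ_{c,ν}(u(t)) ≥ 2^q}` IS the Lebesgue
measure of the residence set `(T/2,T) ∩ {Λ_{c,ν}(u(t)) ≥ 2^q}`: the floor (`residence_floor`) and the
budget (`sum_innerResidence_lt_top`) speak about ONE number `τ_res(q)`. [cite: CheskidovShvydkoy2011, Lemma 4.1] -/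
theorem innerResidence_eq_residence {c ν T : ℝ}
    {u : ℝ → EuclideanSpace ℝ (Fin 3) → EuclideanSpace ℝ (Fin 3)} (hLH : IsLerayHopfOn T ν 0 (u 0) u)
    (hT : 0 < T) (q : ℕ) :
    (∫⁻ τ in Ioo (T / 2) T, {τ | (2 : ℝ≥0∞) ^ q ≤ dissipationWavenumber c ν (u τ)}.indicator
        (fun _ => (1 : ℝ≥0∞)) τ) =
      volume (Ioo (T / 2) T ∩ {τ | (2 : ℝ≥0∞) ^ q ≤ dissipationWavenumber c ν (u τ)}) :=
  hLH.lintegral_indicator_le_dissipationWavenumber_eq c _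
    (Ioo_subset_Ioc_self.trans (Ioc_subset_Ioc (by linarith) le_rfl))

/-- **Residence budget in the floor's currency** (unconditional; Cheskidov–Shvydkoy 2014 Lemma 4.1 +
measurability): for `T > 0` and `u` Leray–Hopf on `[0,T]` from `u 0`, for every `N`,
`∑_{q ≤ N} 2^q · |(T/2,T) ∩ {Λ_{c,ν}(u(t)) ≥ 2^q}| ≤ 2 ∫_{(T/2,T)} Λ_{c,ν}(u(t)) dt`. [cite: CheskidovShvydkoy2011, Lemma 4.1] -/
theorem sum_residence_le {c ν T : ℝ}
    {u : ℝ → EuclideanSpace ℝ (Fin 3) → EuclideanSpace ℝ (Fin 3)} (hLH : IsLerayHopfOn T ν 0 (u 0) u)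
    (hT : 0 < T) (N : ℕ) :
    ∑ q ∈ Finset.range (N + 1), (2 : ℝ≥0∞) ^ q *
        volume (Ioo (T / 2) T ∩ {τ | (2 : ℝ≥0∞) ^ q ≤ dissipationWavenumber c ν (u τ)}) ≤
      2 * ∫⁻ τ in Ioo (T / 2) T, dissipationWavenumber c ν (u τ) := by
  have h := sum_innerResidence_le c ν T u N
  simp_rw [innerResidence_eq_residence hLH hT] at h
  exact h

/-- **The weighted residence times of a Leray–Hopf solution are summable**: for `c > 0`, `ν > 0`,
`T > 0` and `u` Leray–Hopf on `[0,T]` from `u 0`,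
`∑_q 2^q · |(T/2,T) ∩ {Λ_{c,ν}(u(t)) ≥ 2^q}| ≤ 2 ∫_{(T/2,T)} Λ < ∞` (the full series, in `[0,∞]`).
Read with `residence_floor`: under blow-up (and Cheskidov–Dai's criterion) the SAME residence times
`τ_res(q)` satisfy `2^q · U_q · τ_res(q) > c` at infinitely many `q` while `∑_q 2^q τ_res(q) < ∞` — the
front must visit infinitely many levels for at least `c` local turn-over times each, on a summable
total high-level time budget. [cite: CheskidovShvydkoy2011, Lemma 4.1] -/
theorem tsum_residence_lt_top {c ν T : ℝ}
    {u : ℝ → EuclideanSpace ℝ (Fin 3) → EuclideanSpace ℝ (Fin 3)} (hLH : IsLerayHopfOn T ν 0 (u 0) u)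
    (hc : 0 < c) (hν : 0 < ν) (hT : 0 < T) :
    ∑' q : ℕ, (2 : ℝ≥0∞) ^ q *
        volume (Ioo (T / 2) T ∩ {τ | (2 : ℝ≥0∞) ^ q ≤ dissipationWavenumber c ν (u τ)}) < ∞ := by
  obtain ⟨C, hC⟩ := exists_lintegral_dissipationWavenumber_le
  have hfin : ∫⁻ τ in Ioo 0 T, dissipationWavenumber c ν (u τ) < ∞ :=
    (hC c ν T (u 0) u hc hν hT hLH).trans_lt
      (ENNReal.add_lt_top.2 ⟨ENNReal.ofReal_lt_top, ENNReal.ofReal_lt_top⟩)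
  have hsub : Ioo (T / 2) T ⊆ Ioo 0 T := Ioo_subset_Ioo (by linarith) le_rfl
  have hhalf : 2 * ∫⁻ τ in Ioo (T / 2) T, dissipationWavenumber c ν (u τ) < ∞ :=
    ENNReal.mul_lt_top (by simp) ((lintegral_mono_set hsub).trans_lt hfin)
  rw [ENNReal.tsum_eq_iSup_nat]
  refine lt_of_le_of_lt (iSup_le fun N => ?_) hhalf
  cases N with
  | zero => simp
  | succ N => exact sum_residence_le hLH hT N

end OneClock

/-! ## The residence floor in ENERGY currency: `τ_res(q) ≳ E₀^{-1/2} 2^{-5q/2}` infinitely often -/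
section EnergyFloor

/-- **Level sup-amplitudes of a Leray–Hopf solution are controlled by the energy** (Bernstein
`L² → L^∞` on blocks, tree `exists_eLpNorm_top_blockFn_le`, + Leray's energy inequality, tree
`IsLerayHopfOn.eLpNorm_le_eLpNorm_datum`): `sup_{t ∈ (T/2,T)} ‖Δ̇_q u(t)‖_∞ ≤ C · 2^{3q/2} · ‖u(0)‖_{L²}`
with an absolute `C`, for `ν ≥ 0` and `u` Leray–Hopf on `[0,T]` from `u 0`. [cite: BahouriCheminDanchin2011, Lemma 2.1] -/
theorem exists_blockSup_le_energy :
    ∃ C : ℝ≥0, ∀ (ν T : ℝ), 0 ≤ ν →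
      ∀ (u : ℝ → EuclideanSpace ℝ (Fin 3) → EuclideanSpace ℝ (Fin 3)), IsLerayHopfOn T ν 0 (u 0) u →
      ∀ q : ℕ, (⨆ τ ∈ Ioo (T / 2) T, eLpNorm (blockFn (q : ℤ) (u τ)) ∞ volume) ≤
        C * (2 : ℝ≥0∞) ^ ((q : ℝ) * (3 / 2)) * eLpNorm (u 0) 2 volume := by
  obtain ⟨C, hC⟩ := exists_eLpNorm_top_blockFn_le (E := EuclideanSpace ℝ (Fin 3)) (ι := Fin 3)
  refine ⟨C, fun ν T hν u hLH q => iSup₂_le fun τ hτ => ?_⟩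
  have hτ' : τ ∈ Icc 0 T := ⟨by linarith [hτ.1, hτ.2, (show 0 ≤ T from by linarith [hτ.1, hτ.2])], hτ.2.le⟩
  have h1 := hC (q : ℤ) (u τ) (hLH.memLp τ hτ')
  have h2 : eLpNorm (u τ) 2 volume ≤ eLpNorm (u 0) 2 volume :=
    hLH.eLpNorm_le_eLpNorm_datum hν (hLH.memLp 0 ⟨le_rfl, hτ'.1.trans hτ'.2⟩) hτ'
  have hexp : ((q : ℤ) : ℝ) * Module.finrank ℝ (EuclideanSpace ℝ (Fin 3)) * 2⁻¹ = (q : ℝ) * (3 / 2) := by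
    rw [finrank_euclideanSpace_fin]; push_cast; ring
  rw [hexp] at h1
  exact h1.trans (by gcongr)

/-- **The residence floor in energy currency.** Conditionally on `cheskidov_dai_occupation`: with
absolute `c > 0` and `C`, every maximal smooth solution with finite lifespan `T`, Leray–Hopf from its
rapidly decaying datum, has `c < C · 2^{5q/2} · ‖u(0)‖_{L²} · |(T/2,T) ∩ {Λ_{c,ν}(u(t)) ≥ 2^q}|` at
INFINITELY MANY `q` — the front dwells at or above level `q` for `τ_res(q) ≳ E₀^{-1/2} k_q^{-5/2}`,
infinitely often (`residence_floor` + `exists_blockSup_le_energy`); with `tsum_residence_lt_top`: the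
weak-`L^{5/2}` tail `limsup_q k_q^{5/2} |{t ∈ (T/2,T) : Λ ≥ k_q}|` of a blow-up's front is positive while
`Λ` stays integrable (hedged reading). [cite: CheskidovDai2015, §1 Thm. 1.1] -/
theorem residence_floor_energy (h : cheskidov_dai_occupation) :
    ∃ c : ℝ, 0 < c ∧ ∃ C : ℝ≥0, ∀ (ν T : ℝ), 0 < ν → 0 < T →
      ∀ (u : ℝ → EuclideanSpace ℝ (Fin 3) → EuclideanSpace ℝ (Fin 3))
        (p : ℝ → EuclideanSpace ℝ (Fin 3) → ℝ),
      IsMaximalSmoothSolution ν 0 u p T → IsLerayHopfOn T ν 0 (u 0) u → HasRapidSpatialDecay (u 0) →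
      ∃ᶠ q : ℕ in atTop, ENNReal.ofReal c <
        C * (2 : ℝ≥0∞) ^ ((q : ℝ) * (5 / 2)) * eLpNorm (u 0) 2 volume *
          volume (Ioo (T / 2) T ∩ {τ | (2 : ℝ≥0∞) ^ q ≤ dissipationWavenumber c ν (u τ)}) := by
  obtain ⟨c, hc, H⟩ := residence_floor h
  obtain ⟨C, hC⟩ := exists_blockSup_le_energy
  refine ⟨c, hc, C, fun ν T hν hT u p hmax hLH hdec =>
    (H ν T hν hT u p hmax hLH hdec).mono fun q hq => hq.trans_le ?_⟩
  have hS := hC ν T hν.le u hLH q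
  have hpow : (2 : ℝ≥0∞) ^ q * (C * (2 : ℝ≥0∞) ^ ((q : ℝ) * (3 / 2))) =
      C * (2 : ℝ≥0∞) ^ ((q : ℝ) * (5 / 2)) := by
    rw [← ENNReal.rpow_natCast, mul_left_comm, ← ENNReal.rpow_add _ _ two_ne_zero ENNReal.ofNat_ne_top]
    congr 2
    ring
  calc (2 : ℝ≥0∞) ^ q * (⨆ τ ∈ Ioo (T / 2) T, eLpNorm (blockFn (q : ℤ) (u τ)) ∞ volume) *
        volume (Ioo (T / 2) T ∩ {τ | (2 : ℝ≥0∞) ^ q ≤ dissipationWavenumber c ν (u τ)})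
      ≤ (2 : ℝ≥0∞) ^ q * (C * (2 : ℝ≥0∞) ^ ((q : ℝ) * (3 / 2)) * eLpNorm (u 0) 2 volume) *
        volume (Ioo (T / 2) T ∩ {τ | (2 : ℝ≥0∞) ^ q ≤ dissipationWavenumber c ν (u τ)}) := by
        gcongr
    _ = C * (2 : ℝ≥0∞) ^ ((q : ℝ) * (5 / 2)) * eLpNorm (u 0) 2 volume *
        volume (Ioo (T / 2) T ∩ {τ | (2 : ℝ≥0∞) ^ q ≤ dissipationWavenumber c ν (u τ)}) := by
        rw [← mul_assoc, hpow]

end EnergyFloor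

end Summit.NavierStokesRegularity.FluidComputer.LevelOccupationFloor

end
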